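import Summits.QuantumFields.YangMills.Theorems.AlphaInputsT3ACHistories
import Summits.QuantumFields.YangMills.Theorems.AlphaInputsT3ACv3Pint
import Summits.QuantumFields.YangMills.Theorems.UV3UnitPartitionLowerOfPackage
import HarnessLib

/-!
# `AlphaInputsT3ACPint` — (46) p.267 FOR THE SOCKET-OF-RECORD DATUM `AlphaInputsT3AC.Of.dataT3`: `PintSize` PROVED from the v1 (α) rows `RunAlphaAC`, its
# K-UNIFORM top-level reading `|Pint^{(K)}_K(h, W)| ≤ (C46·M₁³)·θBal(1)²·(2L^m)³`, and the `hPint` row of S-low″ (✓`UV3UnitPartitionLowerOfPackage`) DISCHARGED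

Cell `ym3-torus` (YM ladder rung R3 = continuum `SU(2)` Yang–Mills on the three-torus — a RUNG, NOT d = 4, NOT infinite volume, NOT a mass gap, NOT Clay).
Twin-width seat `ym-ust-19936-w8` (gen 11); `--supports stmt-QuantumFields-19936 --as helper`, count-neutral, definition-free, default heartbeats.
Crux `UnitScaleTilt.HistoryTailL` (stmt-QuantumFields-19936), skeleton of record `Cruxes/HistoryTailL/Lines/pinned_stability.lean` v2′ (★★OWNER RECORD 17aq):
row R-19936-U = `stub_unitEnvelope`, whose (L)-half modulo the T3 (α) package is ✓`UV3UnitPartitionLowerOfPackage.exp_Ecst_le_partitionFn_of_package`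
(`ym3-torus-px12` g12) with TWO displayed window rows `hMain` and `hPint`.  THIS FILE supplies `hPint`.

THE POINT.  (46) p.267 «Σ_{j=1}^k Σ_{Y_j}|𝒫_j(Y_j, U_k)| ≤ O(1)M₁³g²_{k−1}p²(g_{k−1})|Λ_k|» is a lane theorem for the AC tower of ANY (α) package whose step rows
carry (44)∕the degree floor (old slice) and G3D-01∕(28)∕G3D-06∕`hPY`∕G3D-07∕G3D-08∕`hPYZ` (newborn slice): `Bound46AC.abs_pint_le_stdAC`.  The tree reads it for
the v3 package (`AlphaInputsT3ACv3Pint`: `abs_Pint_succ_le_of_alphaV3`, `OfV3At.dataT3v3_pintSize`), whose docstring records «the same wiring serves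
`AlphaAC.RunAlphaAC`».  Here that wiring is run for the v1 package `AlphaInputsT3AC.Of F 𝔠` — the UV3 node's T3 socket of record, the hypothesis of S-low″:
* §1 `AlphaACPint.abs_Pint_succ_le_of_alphaAC` — `RunAlphaAC ⇒ |Pint_{k+1}(h, U)| ≤ (C46·M₁³)·(g_kp(g_k))²·#Ω_{k+1}^{(k+1)}(h)`, every `k < K`, on the `≤`-family;
* §2 `AlphaInputsT3AC.PkgAt.abs_Pint_succ_le` (`g_kp(g_k) = θBal(K − k)`, ✓`PkgAt.eps1_eq`) and ★★ `AlphaInputsT3AC.Of.dataT3_pintSize :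
  PintSize (h.dataT3 γ hγ hγ1 π) 𝔠.b₀ 𝔠.p₀ (𝔠.C46·M₁³)` — the interface schema (46) for the socket datum, listed «NOT PROVED» in `AlphaInputsT3ACData`;
* §3 the top level of every run: `dataT3_Pint_zero_zero` (`Pint^{(0)}_0 = 0`, the lane's `noInteraction0_towerOfAC`), ★ `abs_dataT3_Pint_top_le`
  (`|Pint^{(K)}_K(h, W)| ≤ (C46·M₁³)·θBal(1)²·(2L^m)³` — K-UNIFORM: the unit lattice has `2L^m` sites per direction in every run) and ★★ `dataT3_negCP_le_Pint_top_triv`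
  = the `hPint` binder of ✓`exp_Ecst_le_partitionFn_of_package` VERBATIM (`∃ CP, ∀ K W, PlaqSmall (θBal … 0) W → −CP ≤ Pint^{(K)}_K(triv, W)`; the window guard is idle);
* §4 ★★★ `exp_Ecst_le_partitionFn_of_package_of_main` — S-low″ MODULO THE PACKAGE AND ONE ROW: `hMain` alone (the trivial-history main term bounded on the
  window = ONE membership row «`U_min(triv, W) ∈ regFibrePr F 0 K ε₀ V`» through ✓`mainT_top_le_of_actionBound` ∕ ✓`beta_mul_wilsonAction4_le_of_regFibrePr`;
  [Balaban1985Variational] Thm 1 (8), the EX lane's content) gives `∃ Cl, ∀ K, exp(−Ecst K K − Cl) ≤ ∫ ρ_K dV_K`.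

HONEST SCOPE.  Bookkeeping over the lane's landed (46) engine — the v1 socket's twin of an existing v3 theorem, not a new organ.  CONDITIONAL on
`AlphaInputsT3AC.Of F 𝔠` (the UV3 node's (α) inputs, hypothesis schema); nothing of (41)'s pinned form (S-step), of Theorem 1's upper half, of `stub_unitEnvelope`,
of `stub_pinnedRatio`∕`hP`, of `HistoryTailL` (19936) or of the rung is proved here.  Sorry-free, axioms standard.

References: T. Bałaban, *Ultraviolet stability of three-dimensional lattice pure gauge field theories*, Commun. Math. Phys. **102** (1985) 255–275
[Balaban1985UV3] ((1) p.256, (5)–(6) pp.256–257, (33)–(34) p.264, (43)–(46) pp.266–267, (47) p.267, (61) p.271); T. Bałaban, *Averaging operations for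
lattice gauge theories*, Commun. Math. Phys. **102** (1985) 277–309 [Balaban1985Variational] (Thm 1 (8) p.279).
-/

set_option autoImplicit false

noncomputable section

namespace Summit.QuantumFields.YangMills.Theorems

open MeasureTheory
open scoped BigOperators
open Literature.MathematicalPhysics.QuantumFieldTheory.Balaban1983to89
open Literature.MathematicalPhysics.QuantumFieldTheory.Balaban1983to89.T3ContinuumYM3Torus
open Literature.MathematicalPhysics.QuantumFieldTheory.Balaban1983to89.T3UnitLawDensityEML (ℰp emlDensity)
open Literature.MathematicalPhysics.QuantumFieldTheory.Balaban1983to89.T3UnitScaleTilt (θBal)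
open Literature.MathematicalPhysics.QuantumFieldTheory.Balaban1983to89.T3AlphaInputsAC
open Literature.MathematicalPhysics.QuantumFieldTheory.Balaban1985CMP102
open Literature.MathematicalPhysics.QuantumFieldTheory.Balaban1985CMP102.Setting
open Summit.QuantumFields.Balaban3D.Carriers
open Summit.QuantumFields.Balaban3D.Proofs.Primitives
open Summit.QuantumFields.Balaban3D.Proofs.UVStability3DInputs (adjAct)
open Summit.QuantumFields.Balaban3D.Proofs.GroupModelLieC (lieC)
open Summit.QuantumFields.Balaban3D.Proofs.FamilyLE (thresholds_of_le)
open Summit.QuantumFields.Balaban3D.Proofs.TowerAC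
open Summit.QuantumFields.Balaban3D.Proofs.StandardAC
open Summit.QuantumFields.Balaban3D.Proofs.InputsAC
open Summit.QuantumFields.Balaban3D.Proofs.AlphaAC (AlphaDataAC RunAlphaAC)
open Summit.QuantumFields.Balaban3D.Proofs.Bound46AC (abs_pint_le_stdAC)
open Summit.QuantumFields.YangMills.Theorems.UV3UnitPartitionLowerOfPackage (exp_Ecst_le_partitionFn_of_package)

/-! ## §1 (46) one step up for the AC tower of a v1 package `RunAlphaAC`, on the `≤`-family -/

namespace AlphaACPint

variable {L : ℕ} {S : Scales L} {G : Type} [GaugeGroup G] [MeasurableSpace G] [HaarData G] {𝔊 : GroupModel G} {𝔠 : AlphaConsts L 𝔊.N}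
  {X : ExternalInputsAC S G} {𝔖 : ∀ k, StepSeries S G ↥(lieC 𝔊) (nblkOf S 𝔠.lane.carrier k) k} {𝔄 : AlphaDataAC 𝔊 𝔠 X 𝔖}
  (hle : S.g ^ 2 * S.ε₀ ≤ (min 𝔠.gamma0 1) ^ 2)
include hle

/-- **(46) FOR THE AC TOWER OF A v1 PACKAGE `RunAlphaAC`, ONE STEP UP, every `k < K`** (on the `≤`-family `g²ε₀ ≤ (min γ₀ 1)²`):
`|Pint_{k+1}(h, U)| ≤ (C46·M₁³)·(g_kp(g_k))²·#Ω_{k+1}^{(k+1)}(h)` — `Bound46AC.abs_pint_le_stdAC` fed by the rows `h44`/`hfloor` (old slice), `chart`/`bound28`/`far_le`/`hPY`/`hPYZ`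
+ the binders `𝔄.Λc`/`𝔄.N45` (newborn slice), the thresholds `γ₄₆` and the (28)-smallness from `g_k ≤ γ₀` (`FamilyLE.thresholds_of_le`).  The v1 twin of
`AlphaV3AC.abs_Pint_succ_le_of_alphaV3` (same wiring; only rows shared by both packages are read). [cite: Balaban1985UV3, (44)–(46) p.267 + (33)–(34) p.264 + (61) p.271] -/
theorem abs_Pint_succ_le_of_alphaAC (R : RunAlphaAC 𝔊 𝔠 X 𝔖 𝔄) (k : ℕ) (hk : k + 1 ≤ S.K) (h : Hist S.P (k + 1))
    (U : GaugeField S.P (k + 1) G) :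
    |(inputOfAC 𝔠.lane X 𝔖).Pint (k + 1) h U| ≤
      (𝔠.C46 * (𝔠.M₁ : ℝ) ^ 3) * (S.gk k * B10.pFun 𝔠.b₀ 𝔠.p₀ (S.gk k)) ^ 2 * (LamFin 𝔠.lane.carrier.M₁ (rcolOf S 𝔠.lane.carrier) k h).card := by
  rw [𝔠.C46_mul_M₁_cube_eq]
  exact abs_pint_le_stdAC X 𝔠.lane.carrier 𝔖 𝔠.C44_nonneg 𝔠.B₃_pos.le 𝔠.κ₁_pos 𝔠.M₁_pos 𝔠.b₀_pos 𝔠.p₀_pos 𝔠.chart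
    (by linarith [𝔠.kappa_ge]) 𝔠.C25_nonneg 𝔠.C63_nonneg (lt_of_lt_of_le one_pos 𝔠.one_le_r₀)
    (fun j hj => (R.steps j hj).h44) (fun j hj => (R.steps j hj).hfloor) (fun j hj => (thresholds_of_le hle j (by omega)).2.1)
    (fun j hj => (R.steps j hj).chart) (fun j hj => (R.steps j hj).bound28) (fun j hj => (thresholds_of_le hle j (by omega)).2.2.2.2)
    (fun j hj => (R.steps j hj).far_le) (fun j hj => (R.steps j hj).hPY) (π := fun j => adjAct 𝔊 (P := S.P) j) (fun j _ => 𝔄.Λc j)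
    (fun j _ => 𝔄.N45 j) (fun j hj => (R.steps j hj).hPYZ) k hk h U

end AlphaACPint

/-! ## §2 At the T³ package of record: `PintSize` for the socket datum `dataT3` -/

section T3

variable {F : T3Family} {𝔠 : AlphaConsts F.L (suGroupModel 2).N} {γ : ℝ} {hγ : 0 < γ} {hγ1 : γ ≤ (min 𝔠.gamma0 1) ^ 2} {K : ℕ}

/-- **(46) FOR THE v1 RECORD'S TOWER, ONE STEP UP**: `|Pint_{k+1}(h, W)| ≤ (C46·M₁³)·θBal(K − k)²·#Ω_{k+1}^{(k+1)}(h)` for `k < K` (`g_kp(g_k) = θBal(K − k)`, ✓`PkgAt.eps1_eq`).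
[cite: Balaban1985UV3, (46) p.267] -/
theorem AlphaInputsT3AC.PkgAt.abs_Pint_succ_le (p : AlphaInputsT3AC.PkgAt F 𝔠 γ hγ hγ1 K) (k : ℕ) (hk : k + 1 ≤ K) (h : Hist (F.P K) (k + 1))
    (W : GaugeField (F.P K) (k + 1) (Matrix.specialUnitaryGroup (Fin 2) ℂ)) :
    |p.T.Pint (k + 1) h W| ≤ (𝔠.C46 * (𝔠.M₁ : ℝ) ^ 3) * θBal F.L γ 𝔠.b₀ 𝔠.p₀ (K - k) ^ 2 *
      (LamFin 𝔠.lane.carrier.M₁ (rcolOf (T3Scales F γ hγ (hγ1.trans (sq_min_one_le _ 𝔠.gamma0_pos)) K) 𝔠.lane.carrier) k h).card := by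
  have h46 := AlphaACPint.abs_Pint_succ_le_of_alphaAC (T3Scales_window F 𝔠 γ hγ hγ1 K) p.run k hk h W
  have hε : (T3Scales F γ hγ (hγ1.trans (sq_min_one_le _ 𝔠.gamma0_pos)) K).gk k *
      B10.pFun 𝔠.b₀ 𝔠.p₀ ((T3Scales F γ hγ (hγ1.trans (sq_min_one_le _ 𝔠.gamma0_pos)) K).gk k) = θBal F.L γ 𝔠.b₀ 𝔠.p₀ (K - k) := by
    rw [← p.eps1_eq k (by omega)]
    rfl
  rw [hε] at h46
  exact h46

variable (h : AlphaInputsT3AC.Of F 𝔠) (γ : ℝ) (hγ : 0 < γ) (hγ1 : γ ≤ (min 𝔠.gamma0 1) ^ 2) (π : AlphaInputsT3AC.PolymerT3 F)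

/-- ★★ **`PintSize` FOR THE SOCKET-OF-RECORD DATUM `dataT3`, with `CP := C46·M₁³`**: for every run `K`, level `1 ≤ j ≤ K`, history `h` and field `W`,
`|Pint^{(K)}_j(h, W)| ≤ CP·θBal(K − j + 1)²·(sitesPerDir j)³` — (46) p.267 for the package's AC tower (`PkgAt.abs_Pint_succ_le`) with the volume `|Λ_j| ≤ |T^{(j)}|`
(✓`card_lamFin_le_sitesPerDir_cube`); the schema's `Adm` guard is not used.  The interface schema listed «NOT PROVED» in `AlphaInputsT3ACData` is thereby supplied for
the v1 package exactly as `OfV3At.dataT3v3_pintSize` supplies it for v3. [cite: Balaban1985UV3, (46) p.267] -/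
theorem AlphaInputsT3AC.Of.dataT3_pintSize : PintSize (h.dataT3 γ hγ hγ1 π) 𝔠.b₀ 𝔠.p₀ (𝔠.C46 * (𝔠.M₁ : ℝ) ^ 3) := by
  intro K j r W hj hj1 _
  obtain ⟨k, rfl⟩ : ∃ k, j = k + 1 := ⟨j - 1, by omega⟩
  have h46 := (h.pkgAt γ hγ hγ1 K).abs_Pint_succ_le k hj r W
  have hvol := card_lamFin_le_sitesPerDir_cube (F := F) (K := K) 𝔠.lane.carrier.M₁
    (rcolOf (T3Scales F γ hγ (hγ1.trans (sq_min_one_le _ 𝔠.gamma0_pos)) K) 𝔠.lane.carrier) k r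
  have hC : 0 ≤ 𝔠.C46 * (𝔠.M₁ : ℝ) ^ 3 * θBal F.L γ 𝔠.b₀ 𝔠.p₀ (K - k) ^ 2 :=
    mul_nonneg (mul_nonneg 𝔠.C46_nonneg (pow_nonneg (Nat.cast_nonneg _) _)) (sq_nonneg _)
  have hKk : K - (k + 1) + 1 = K - k := by omega
  show |(h.pkgAt γ hγ hγ1 K).T.Pint (k + 1) r W| ≤ _
  rw [hKk]
  exact h46.trans (mul_le_mul_of_nonneg_left hvol hC)

/-! ## §3 The top level of every run: `Pint^{(0)}_0 = 0`, a K-uniform bound on `|Pint^{(K)}_K|`, and the `hPint` row of S-low″ -/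

/-- **NO INTERACTION IN RUN `0`**: `Pint^{(0)}_0(h, W) = 0` for the socket datum (the lane's AC tower has `Pint 0 ≡ 0` by construction, `InputsAC.noInteraction0_towerOfAC`;
(1) p.256: `ρ₀` carries no interaction terms). [cite: Balaban1985UV3, (1) p.256] -/
theorem AlphaInputsT3AC.Of.dataT3_Pint_zero_zero (r : (h.dataT3 γ hγ hγ1 π).Hist 0 0)
    (W : GaugeField (F.P 0) 0 (Matrix.specialUnitaryGroup (Fin 2) ℂ)) :
    (h.dataT3 γ hγ hγ1 π).Pint 0 0 r W = 0 :=
  noInteraction0_towerOfAC 𝔠.lane (h.pkgAt γ hγ hγ1 0).X (h.pkgAt γ hγ hγ1 0).𝔖 r W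

/-- ★ **THE K-UNIFORM TOP-LEVEL READING OF (46)**: for every run `K`, every history `h` and every unit-lattice field `W`,
`|Pint^{(K)}_K(h, W)| ≤ (C46·M₁³)·θBal(1)²·(2L^m)³` — (46) one step up at `k + 1 = K` (`PkgAt.abs_Pint_succ_le`: `θBal(K − (K−1)) = θBal(1)`, `#Ω_K^{(K)}(h) ≤ #T^{(K)} = (2L^m)³` by
✓`card_lamFin_le_sitesPerDir_cube` and `sitesPerDir K = 2L^m`), and `Pint^{(0)}_0 = 0` at `K = 0`; no admissibility guard.  (46) p.267 at `k = K`: «Thus the sum is not only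
convergent, but also small» — here only boundedness, uniformly in the run, is kept. [cite: Balaban1985UV3, (46) p.267] -/
theorem AlphaInputsT3AC.Of.abs_dataT3_Pint_top_le (K : ℕ) (r : (h.dataT3 γ hγ hγ1 π).Hist K K)
    (W : GaugeField (F.P K) K (Matrix.specialUnitaryGroup (Fin 2) ℂ)) :
    |(h.dataT3 γ hγ hγ1 π).Pint K K r W| ≤
      𝔠.C46 * (𝔠.M₁ : ℝ) ^ 3 * θBal F.L γ 𝔠.b₀ 𝔠.p₀ 1 ^ 2 * (2 * (F.L : ℝ) ^ F.m) ^ 3 := by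
  have hC : 0 ≤ 𝔠.C46 * (𝔠.M₁ : ℝ) ^ 3 * θBal F.L γ 𝔠.b₀ 𝔠.p₀ 1 ^ 2 :=
    mul_nonneg (mul_nonneg 𝔠.C46_nonneg (pow_nonneg (Nat.cast_nonneg _) _)) (sq_nonneg _)
  rcases Nat.eq_zero_or_pos K with rfl | hK
  · rw [h.dataT3_Pint_zero_zero γ hγ hγ1 π r W, abs_zero]
    exact mul_nonneg hC (by positivity)
  · obtain ⟨k, rfl⟩ : ∃ k, K = k + 1 := ⟨K - 1, by omega⟩
    have h46 := (h.pkgAt γ hγ hγ1 (k + 1)).abs_Pint_succ_le k le_rfl r W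
    have hvol := card_lamFin_le_sitesPerDir_cube (F := F) (K := k + 1) 𝔠.lane.carrier.M₁
      (rcolOf (T3Scales F γ hγ (hγ1.trans (sq_min_one_le _ 𝔠.gamma0_pos)) (k + 1)) 𝔠.lane.carrier) k r
    have htop : (F.P (k + 1)).sitesPerDir (k + 1) = 2 * F.L ^ F.m := by simp [Params.sitesPerDir]
    rw [htop] at hvol
    push_cast at hvol
    have hk1 : k + 1 - k = 1 := by omega
    rw [hk1] at h46
    show |(h.pkgAt γ hγ hγ1 (k + 1)).T.Pint (k + 1) r W| ≤ _
    exact h46.trans (mul_le_mul_of_nonneg_left hvol hC)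

/-- ★★ **THE `hPint` ROW OF S-low″, DISCHARGED** — verbatim the binder `hPint` of ✓`UV3UnitPartitionLowerOfPackage.exp_Ecst_le_partitionFn_of_package`: on the small-field
window of the unit lattice (indeed everywhere — the guard is idle) the trivial-history interaction sum of every run is bounded below by ONE constant,
`−CP ≤ Pint^{(K)}_K(triv, W)` with `CP := (C46·M₁³)·θBal(1)²·(2L^m)³` (`abs_dataT3_Pint_top_le`). [cite: Balaban1985UV3, (46) p.267] -/
theorem AlphaInputsT3AC.Of.dataT3_negCP_le_Pint_top_triv :
    ∃ CP : ℝ, ∀ (K : ℕ) (W : GaugeField (F.P K) K (Matrix.specialUnitaryGroup (Fin 2) ℂ)),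
      PlaqSmall (θBal F.L γ 𝔠.b₀ 𝔠.p₀ 0) W →
        -CP ≤ (h.dataT3 γ hγ hγ1 π).Pint K K ((h.dataT3 γ hγ hγ1 π).triv K K) W :=
  ⟨𝔠.C46 * (𝔠.M₁ : ℝ) ^ 3 * θBal F.L γ 𝔠.b₀ 𝔠.p₀ 1 ^ 2 * (2 * (F.L : ℝ) ^ F.m) ^ 3, fun K W _ =>
    (abs_le.mp (h.abs_dataT3_Pint_top_le γ hγ hγ1 π K ((h.dataT3 γ hγ hγ1 π).triv K K) W)).1⟩

/-- The same row with the two-sided bound and the constant displayed: `|Pint^{(K)}_K(triv, W)| ≤ CP`, `0 ≤ CP`, every run and every unit-lattice field.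
[cite: Balaban1985UV3, (46) p.267] -/
theorem AlphaInputsT3AC.Of.exists_abs_dataT3_Pint_top_triv_le :
    ∃ CP : ℝ, 0 ≤ CP ∧ ∀ (K : ℕ) (W : GaugeField (F.P K) K (Matrix.specialUnitaryGroup (Fin 2) ℂ)),
      |(h.dataT3 γ hγ hγ1 π).Pint K K ((h.dataT3 γ hγ hγ1 π).triv K K) W| ≤ CP :=
  ⟨𝔠.C46 * (𝔠.M₁ : ℝ) ^ 3 * θBal F.L γ 𝔠.b₀ 𝔠.p₀ 1 ^ 2 * (2 * (F.L : ℝ) ^ F.m) ^ 3,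
    mul_nonneg (mul_nonneg (mul_nonneg 𝔠.C46_nonneg (pow_nonneg (Nat.cast_nonneg _) _)) (sq_nonneg _)) (by positivity),
    fun K W => h.abs_dataT3_Pint_top_le γ hγ hγ1 π K _ W⟩

/-! ## §4 S-low″ modulo the package and ONE row -/

/-- ★★★ **S-low″ MODULO THE PACKAGE AND THE MAIN-TERM ROW ALONE**: under `AlphaInputsT3AC.Of F 𝔠` at `γ ∈ (0, (min γ₀ 1)²]`, IF the trivial-history main term
`mainT^{(K)}_K(triv, W)` is bounded by one constant on the small-field window `{PlaqSmall θBal(0)}` of the unit lattice of every run, THEN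
`∃ Cl, ∀ K, exp(−Ecst K K − Cl) ≤ ∫ ρ_K dV_K` — ✓`exp_Ecst_le_partitionFn_of_package` with its `hPint` row supplied by `dataT3_negCP_le_Pint_top_triv`.  The remaining row
is ONE membership row («`U_min(triv, W) ∈ regFibrePr F 0 K ε₀ V`», [Balaban1985Variational] Thm 1 (8) — the EX lane) through ✓`mainT_top_le_of_actionBound` ∕
✓`beta_mul_wilsonAction4_le_of_regFibrePr`. [cite: Balaban1985UV3, (47) p.267, (5)–(6) pp.256–257, (46) p.267] -/
theorem AlphaInputsT3AC.Of.exp_Ecst_le_partitionFn_of_package_of_main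
    (hMain : ∃ Cm : ℝ, ∀ (K : ℕ) (W : GaugeField (F.P K) K (Matrix.specialUnitaryGroup (Fin 2) ℂ)),
      PlaqSmall (θBal F.L γ 𝔠.b₀ 𝔠.p₀ 0) W →
        (h.dataT3 γ hγ hγ1 π).mainT K K ((h.dataT3 γ hγ hγ1 π).triv K K) W ≤ Cm) :
    ∃ Cl : ℝ, ∀ K : ℕ,
      Real.exp (-((h.dataT3 γ hγ hγ1 π).Ecst K K) - Cl) ≤
        ∫ V, emlDensity F γ K K V ∂fieldMeasure (F.P K) K (Matrix.specialUnitaryGroup (Fin 2) ℂ) :=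
  exp_Ecst_le_partitionFn_of_package h γ hγ hγ1 π hMain (h.dataT3_negCP_le_Pint_top_triv γ hγ hγ1 π)

/-- ★★★ **S-low″ MODULO THE PACKAGE AND ONE ACTION ROW**: the same with the main-term row in the form «`β_K·A(U_min(triv, W)) ≤ Cm` on the window» (`mainT = β_K·A(U_min)`,
✓`mainT_top_le_of_actionBound`) — which ✓`beta_mul_wilsonAction4_le_of_regFibrePr` discharges at `Cm := 12·ε₀²·L^{3m}∕γ` from the membership of `U_min(triv, W)` in print's
regular fibre over the unit lattice. [cite: Balaban1985UV3, (5) p.256, (41)–(42) p.266, (46)–(47) p.267; Balaban1985Variational, Thm 1 (8) p.279] -/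
theorem AlphaInputsT3AC.Of.exp_Ecst_le_partitionFn_of_package_of_actionBound {Cm : ℝ}
    (hA : ∀ (K : ℕ) (W : GaugeField (F.P K) K (Matrix.specialUnitaryGroup (Fin 2) ℂ)),
      PlaqSmall (θBal F.L γ 𝔠.b₀ 𝔠.p₀ 0) W →
        (F.scheme ℰp γ).β K * wilsonAction4 ((h.dataT3 γ hγ hγ1 π).Umin K K ((h.dataT3 γ hγ hγ1 π).triv K K) W) ≤ Cm) :
    ∃ Cl : ℝ, ∀ K : ℕ,
      Real.exp (-((h.dataT3 γ hγ hγ1 π).Ecst K K) - Cl) ≤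
        ∫ V, emlDensity F γ K K V ∂fieldMeasure (F.P K) K (Matrix.specialUnitaryGroup (Fin 2) ℂ) :=
  h.exp_Ecst_le_partitionFn_of_package_of_main γ hγ hγ1 π
    ⟨Cm, UV3UnitPartitionLowerOfPackage.mainT_top_le_of_actionBound h γ hγ hγ1 π hA⟩

end T3

end Summit.QuantumFields.YangMills.Theorems

end
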